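import Summits.BirchSwinnertonDyer.BirchSwinnertonDyer.Theorems.EdixhovenFibreFiveSevenUnstarredOrdinaryManinUnitOfSL2NeronValuesBar
import Summits.BirchSwinnertonDyer.BirchSwinnertonDyer.Theorems.EdixhovenFibreFiveSevenRecTowerUnstarredSupersingularCells
import HarnessLib

/-!
# [REC-tower] PROVED on all twelve potentially good additive cells at `p ∈ {5, 7}`; Manin's `p`-part at every lattice-optimal datum there GRANTED ONLY
# {P1-bar, modularity}; LOW (23884), TDS57 (22227), KP57 (23810) BY NAME; the rung W-ALL/2.p>=5.r1 sans [REC-tower] except TDS11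
# (route `EdixhovenFibreFiveSeven`, line `kato-lever`; seat `bsd-line-edix-p4` g31, width; joint with LEAD `bsd-line-edix-p1` g33)

HONEST FRAMING. TOOL theorems only (no definition, no named fact, no instance, no `sorry`; file-local instance keys on `ℚ_v` byte-identical to the accepted
`…CellsOfRecTowerAtIntrinsicAlt` l.65–69); helper `--supports` TDS57 (stmt-BirchSwinnertonDyer-22227). LOW / TDS57 / KP57 stay OPEN — they are proved here
CONDITIONALLY on P1-bar (`Kato2004.exists_member_sl2ZetaElement_neron_values_bar`, print XL, cite-only) and modularity (`exists_isNewformOf`, cite-only; TDS57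
carries it as its own first binder); the rung closer is CONDITIONAL on P1-bar, the crux TDS11 (22228), the three AKR-shared OPEN cruxes and the two published-input
bundles. **BSD is not proved by any of this; no W-ALL class theorem is proved by this.**

WHAT. With the K★ stubs (`stub_localFormulaOrdinaryCells` p801055, `stub_localFormulaSupersingularCells` p789571 — the six STARRED cells), this seat's
`recTowerUnstarredOrdinaryCells` (p802720 — `(5; III)`, `(7; II)`, `(7; IV)`) and the LEAD's `recTowerUnstarredSupersingularCells` (p802935 — `(5; II)`, `(5; IV)`,
`(7; III)`, via (N1‴) tower descent), the body of Kato's explicit reciprocity law [REC-tower] at the cyclotomic towers `ℚ_v ⊆ ℚ(ζ_m)_w` is a THEOREM for every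
globally minimal curve with additive potentially good reduction at `p ∈ {5, 7}` and `E[p]` irreducible:

* ★★★★ `recTowerPotGoodFiveSeven` — the twelve-cell dispatcher (`ord_p Δ_min ≤ 4`: ordinary `(5,3),(7,2),(7,4)` / supersingular `(5,2),(5,4),(7,3)`, `2 ≤ ord_p Δ_min`
  by `two_le_padicValInt_minimalDiscriminantInt_of_addv`; `4 < ord_p Δ_min`: the starred halves `(p = 5 ↔ ord = 9)` / its negation through
  `recTower{Ordinary,Supersingular}Cells_of_localFormulaAlt` ∘ the landed LOC stubs).
* ★★★★ `not_dvd_optimal_c_potGood_of_sl2NeronValuesBar` — **Manin's `p`-part at every lattice-optimal datum of every `W/ℚ` with additive potentially good reduction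
  at `p ∈ {5, 7}` and `E[p]` irreducible, GRANTED ONLY P1-bar and modularity**: `UnstarredOrdinaryManinUnitOfSL2NeronValuesBar.not_dvd_optimal_c_of_sl2NeronValuesBar_of_recAt`
  (the g19 master theorem re-keyed to the REC socket, this seat) with the socket DISCHARGED by `recTowerPotGoodFiveSeven`. This is
  `OptimalManinUnitFiveSevenOfReciprocityLaw.not_dvd_optimal_c_fiveSeven_of_reciprocityLaw_of_sl2NeronValuesBar` WITHOUT `hrec`: Kato 1993 II Thm. 1.4.1 (4) is no
  longer an input at `p ∈ {5, 7}`.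
* ★★ `exists_datum_not_dvd_c_potGood_of_sl2NeronValuesBar` — a conductor-level datum with `p ∤ c` on every such `V` (optimal member `X12.exists_isIsogenous_optimal`,
  cell data along the isogeny, prime-to-`p` transport back).
* By name, GRANTED ONLY {modularity, P1-bar}: ★★★ `supersingularTorsionOptimalManinUnitFive_of_sl2NeronValuesBar` (LOW 23884), ★★★
  `kpResidueManinUnitFiveSeven_of_sl2NeronValuesBar` (KP57 23810), ★★★ `twistDegreeStepFiveSeven_of_sl2NeronValuesBar : P1-bar → TwistDegreeStepFiveSeven` (TDS57 22227;
  modularity is the item's own binder), and once more K★ / CORNER (`starredOptimalManinUnitFiveSeven_of_sl2NeronValuesBar'`,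
  `kummerCornerTorsionOptimalManinUnit_of_sl2NeronValuesBar'`) as corollaries of the twelve-cell theorem.
* ★★ `wAllExclAdditiveFiveLeRankOne_of_akr_of_twistDegreeStepOrdinary_of_sl2NeronValuesBar` — the RUNG `Summit.BirchSwinnertonDyer.WAllExclAdditiveFiveLeRankOne` through
  the route's landed `EdixhovenFibreFiveSevenAssembly.assembly_proof`, GRANTED P1-bar, the crux TDS11 `TwistDegreeStepOrdinary` (22228 — the `p ≥ 11` (G)-ordinary
  cells, where [REC-tower] is not yet a tree theorem: LEAD g33's lane), the three AKR-shared OPEN cruxes and the two published-input bundles —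
  `wAllExclAdditiveFiveLeRankOne_of_akr_of_reciprocityLaw_of_sl2NeronValuesBar` (g19) with `hrec` REPLACED by the item TDS11.

NET for the route: K★ (22226), CORNER (23883), LOW (23884), KP57 (23810), TDS57 (22227) ⟸ {P1-bar, modularity}; the rung ⟸ {P1-bar, TDS11, AKR cruxes, PUB bundles}.
CONDITIONAL; every item stays OPEN; BSD is not proved.

References: [Kato2004Asterisque] Thm. 6.6 (1), (8.1.3), Thm. 9.7; [Kato1993LNM1553] Ch. II §1.2.4, Prop. 1.2.3, Thm. 1.4.1 (3)–(4); [KostersPannekoek2017] Thm. 1, Cor. 2;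
[Stevens1989] Lemma (5.2); [EdixhovenManin1991] Thm. 3, §4; [ZagierCMB1985] §1; [DokchitserDokchitser2015LocalInvariants] Thm. 5.1 (1); [WZhang2014] Thm. 1.1;
[SilvermanATAEC1994] IV Table 4.1.
-/

set_option autoImplicit false
-- the Theorems namespace of a single-conjunct summit repeats the summit name by design (D-0017)
set_option linter.dupNamespace false

noncomputable section

open scoped Classical MatrixGroups NumberField NNReal

open WeierstrassCurve NumberField IsDedekindDomain Field ValuativeRel
  Literature.NumberTheory.EllipticCurves Literature.NumberTheory.EllipticCurves.ModularForms
  Literature.NumberTheory.EllipticCurves.Rank1Residual Literature.NumberTheory.EllipticCurves.Kato2004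
  Literature.NumberTheory.DiophantineGeometry Rat.HeightOneSpectrum
  Literature.NumberTheory.PAdicHodge Literature.NumberTheory.GaloisRepresentations
  Literature.NumberTheory.GaloisRepresentations.IsNonarchimedeanLocalField
  Literature.NumberTheory.GaloisRepresentations.PeriodRingData
  Summit.BirchSwinnertonDyer.Rank1Residual Summit.BirchSwinnertonDyer.Rank1Residual.Additive
  Summit.BirchSwinnertonDyer.Rank1Residual.GaloisImage
  Summit.BirchSwinnertonDyer.BirchSwinnertonDyer.Theorems
  Summit.BirchSwinnertonDyer.BirchSwinnertonDyer.Theorems.KimAtThreeDeepLowerExpStarOmega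
  Summit.BirchSwinnertonDyer.BirchSwinnertonDyer.Theorems.KimAtThreeDeepLowerExpStarOmegaPlace
  Summit.BirchSwinnertonDyer.BirchSwinnertonDyer.Theorems.UnstarredOrdinaryManinUnitOfSL2NeronValuesBar
  Summit.BirchSwinnertonDyer.BirchSwinnertonDyer.Theses.EdixhovenFibreFiveSeven
  CongruenceSubgroup Complex
open Summit.BirchSwinnertonDyer.BirchSwinnertonDyer.Theorems.KimAtThreeDeepUpperTowerLattice (fact_natCast_mem_primesEquiv_symm)
open Literature.NumberTheory.EllipticCurves.FormalGroupChart (padicLogPointFiniteExt)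

namespace Summit.BirchSwinnertonDyer.BirchSwinnertonDyer.Theorems.PotGoodManinUnitOfSL2NeronValuesBar

-- FILE-LOCAL instance keys, byte-identical to the accepted `…CellsOfRecTowerAtIntrinsicAlt.lean` l.65–69 (no library instance is
-- overridden outside this file): the `Fact (p ∈ v_p)` key and the local-field structures on `ℚ_v = Place.Completion (inr v)`, under
-- which the [REC-tower] body at `ℚ_v ⊆ ℚ(ζ_m)_w` is stated.
attribute [local instance] fact_natCast_mem_primesEquiv_symm
attribute [local instance 100000] NumberField.Place.instAlgebraCompletion
attribute [local instance] valuativeRelPlace topologicalSpacePlace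
attribute [local instance] isNonarchimedeanLocalField_place charZero_place
attribute [local instance] padicAlgebraPlace fact_not_isUnit_place isAdicComplete_place

/-! ### §1 [REC-tower] at every cyclotomic tower, all twelve potentially good cells at `p ∈ {5, 7}` -/

/-- ★★★★ **Kato's explicit reciprocity law [REC-tower] at every cyclotomic tower `ℚ_v ⊆ ℚ(ζ_m)_w` (`p ∤ m`, `w ∣ p`), PROVED for every globally minimal `W′/ℚ`
with ADDITIVE POTENTIALLY GOOD reduction at `p ∈ {5, 7}` (no `Iₙ*` fibre: Kodaira II, III, IV, IV*, III*, II*) and `E[p]` irreducible**: `∃ c₀ ≠ 0` with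
`⟨[η₀], P₀⟩ = Tr_{ℚ_v/ℚ_p}(c₀ · exp*_{d₀}(η₀) · log_{wv} P₀)` on `H¹(ℚ_v, T) × W′(ℚ_v)` and `⟨[η], P⟩ = Tr_{L_w/ℚ_p}(c₀ · exp*_d(η) · log_ν P)` on `H¹(L_w, T) × W′(L_w)`, for
every alternating Weil tower, compatible valuations and compatible Néron line data `(d₀, d)` under the Prop-1.2.3 binders. The twelve-cell dispatcher over the
four landed cell theorems: unstarred ordinary `recTowerUnstarredOrdinaryCells` (edix-p4), unstarred supersingular `recTowerUnstarredSupersingularCells` (edix-p1),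
starred `recTower{Ordinary,Supersingular}Cells_of_localFormulaAlt` ∘ `stub_localFormula{Ordinary,Supersingular}Cells` (the K★ line).
[cite: Kato1993LNM1553, Ch. II §1.2.4, Prop. 1.2.3 and Thm. 1.4.1 (3)–(4)] [cite: BlochKato1990, Prop. 3.8, Example 3.11] [cite: SilvermanATAEC1994, IV Table 4.1]
[cite: Fontaine1982FormesDifferentielles, §5] -/
theorem recTowerPotGoodFiveSeven :
    ∀ (W' : WeierstrassCurve ℚ) [W'.IsElliptic] [W'.IsGloballyMinimal] (p : ℕ) [hp : Fact p.Prime], (p = 5 ∨ p = 7) → Addv W' p → Irr W' p →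
      (∀ (v : HeightOneSpectrum ℤ) (n : ℕ), natGenerator v = p → W'.kodairaSymbolAt v ≠ KodairaSymbol.Istar n) →
      ∀ (m : ℕ) [NeZero m], ¬ p ∣ m →
      ∀ (w : ((primesEquiv (R := 𝓞 ℚ)).symm ⟨p, hp.out⟩).Extension (𝓞 (CyclotomicField m ℚ))) (hw : ((p : ℕ) : 𝓞 (CyclotomicField m ℚ)) ∈ w.1.asIdeal)
      [CharZero (w.1.adicCompletion (CyclotomicField m ℚ))] [Fact (¬ IsUnit ((p : ℕ) : integerC (w.1.adicCompletion (CyclotomicField m ℚ))))]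
      [IsAdicComplete (Ideal.span {((p : ℕ) : integerC (w.1.adicCompletion (CyclotomicField m ℚ)))}) (integerC (w.1.adicCompletion (CyclotomicField m ℚ)))]
      (hL : valuation (w.1.adicCompletion (CyclotomicField m ℚ)) ((p : ℕ) : (w.1.adicCompletion (CyclotomicField m ℚ))) < 1), letI := LocalField.adicCompletionPadicAlgebra w.1 p hw
      letI : Algebra (Place.Completion (K := ℚ) (Sum.inr ((primesEquiv (R := 𝓞 ℚ)).symm ⟨p, hp.out⟩))) (w.1.adicCompletion (CyclotomicField m ℚ)) :=
      inferInstanceAs (Algebra (((primesEquiv (R := 𝓞 ℚ)).symm ⟨p, hp.out⟩).adicCompletion ℚ) (w.1.adicCompletion (CyclotomicField m ℚ)))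
      ∀ (wv : Valuation (Place.Completion (Sum.inr ((primesEquiv (R := 𝓞 ℚ)).symm ⟨p, hp.out⟩) : Place ℚ)) ℝ≥0) [wv.Compatible]
      [(W'.baseChange (Place.Completion (Sum.inr ((primesEquiv (R := 𝓞 ℚ)).symm ⟨p, hp.out⟩) : Place ℚ))).IsIntegral wv.integer]
      (ν : Valuation (w.1.adicCompletion (CyclotomicField m ℚ)) ℝ≥0) [ν.Compatible] [(W'.baseChange (w.1.adicCompletion (CyclotomicField m ℚ))).IsIntegral ν.integer]
      (e : (k : ℕ) → geomTorsion W' ((p ^ k : ℕ) : ℤ) → geomTorsion W' ((p ^ k : ℕ) : ℤ) → AlgebraicClosure ℚ) (hμ : ∀ k S T, e k S T ^ (p ^ k) = 1)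
      (hadd₁ : ∀ k S₁ S₂ T, e k (S₁ + S₂) T = e k S₁ T * e k S₂ T) (hadd₂ : ∀ k S T₁ T₂, e k S (T₁ + T₂) = e k S T₁ * e k S T₂)
      (hgal : ∀ k (σ : absoluteGaloisGroup ℚ) (S T : geomTorsion W' ((p ^ k : ℕ) : ℤ)), σ • e k S T = e k (σ • S) (σ • T))
      (_hnondeg : ∀ k (T : geomTorsion W' ((p ^ k : ℕ) : ℤ)), (∀ S, e k S T = 1) → T = 0) (_halt : ∀ k (S : geomTorsion W' ((p ^ k : ℕ) : ℤ)), e k S S = 1)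
      (hcompat : ∀ k (S T : geomTorsion W' ((p ^ (k + 1) : ℕ) : ℤ)),
      e k (torsionMulHom W' (p ^ (k + 1)) (p ^ k) p (pow_succ p k).symm S) (torsionMulHom W' (p ^ (k + 1)) (p ^ k) p (pow_succ p k).symm T) = e (k + 1) S T ^ p)
      (d₀ : LocalNeronLineAt W' p ((primesEquiv (R := 𝓞 ℚ)).symm ⟨p, hp.out⟩)) (d : LocalNeronLine W' hL ((galRestrictPlace ((primesEquiv (R := 𝓞 ℚ)).symm ⟨p, hp.out⟩)).comp
      (absGaloisRestrict (Place.Completion (Sum.inr ((primesEquiv (R := 𝓞 ℚ)).symm ⟨p, hp.out⟩) : Place ℚ)) (w.1.adicCompletion (CyclotomicField m ℚ))))),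
      (bdRPeriodRingData (valuation_place_lt_one p ((primesEquiv (R := 𝓞 ℚ)).symm ⟨p, hp.out⟩))).CupLogInjective (logCyclotomic p)
      (localRationalTateRep W' p (galRestrictPlace ((primesEquiv (R := 𝓞 ℚ)).symm ⟨p, hp.out⟩))) →
      (∀ z : contOneCocycles (localRationalTateRep W' p (galRestrictPlace ((primesEquiv (R := 𝓞 ℚ)).symm ⟨p, hp.out⟩))).toTopRep,
      (bdRPeriodRingData (valuation_place_lt_one p ((primesEquiv (R := 𝓞 ℚ)).symm ⟨p, hp.out⟩))).HasDualExp (logCyclotomic p)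
      (localRationalTateRep W' p (galRestrictPlace ((primesEquiv (R := 𝓞 ℚ)).symm ⟨p, hp.out⟩))) fun σ => z.1 σ) →
      (bdRPeriodRingData (F := (w.1.adicCompletion (CyclotomicField m ℚ))) (p := p) hL).CupLogInjective (logCyclotomic p) (localRationalTateRep W' p
      ((galRestrictPlace ((primesEquiv (R := 𝓞 ℚ)).symm ⟨p, hp.out⟩)).comp (absGaloisRestrict (Place.Completion (Sum.inr ((primesEquiv (R := 𝓞 ℚ)).symm ⟨p, hp.out⟩) : Place ℚ)) (w.1.adicCompletion (CyclotomicField m ℚ))))) →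
      (∀ z : contOneCocycles (localRationalTateRep W' p
      ((galRestrictPlace ((primesEquiv (R := 𝓞 ℚ)).symm ⟨p, hp.out⟩)).comp (absGaloisRestrict (Place.Completion (Sum.inr ((primesEquiv (R := 𝓞 ℚ)).symm ⟨p, hp.out⟩) : Place ℚ)) (w.1.adicCompletion (CyclotomicField m ℚ))))).toTopRep,
      (bdRPeriodRingData (F := (w.1.adicCompletion (CyclotomicField m ℚ))) (p := p) hL).HasDualExp (logCyclotomic p) (localRationalTateRep W' p
      ((galRestrictPlace ((primesEquiv (R := 𝓞 ℚ)).symm ⟨p, hp.out⟩)).comp (absGaloisRestrict (Place.Completion (Sum.inr ((primesEquiv (R := 𝓞 ℚ)).symm ⟨p, hp.out⟩) : Place ℚ)) (w.1.adicCompletion (CyclotomicField m ℚ)))))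
      fun σ => z.1 σ) → (∀ (η₀ : contOneCocycles (restrictedTateRep W' (Place.Completion (Sum.inr ((primesEquiv (R := 𝓞 ℚ)).symm ⟨p, hp.out⟩) : Place ℚ)) p).toTopRep)
      (ηT : contOneCocycles ((restrictedTateRep W' (Place.Completion (Sum.inr ((primesEquiv (R := 𝓞 ℚ)).symm ⟨p, hp.out⟩) : Place ℚ)) p).restrict
      (absGaloisRestrict (Place.Completion (Sum.inr ((primesEquiv (R := 𝓞 ℚ)).symm ⟨p, hp.out⟩) : Place ℚ)) (w.1.adicCompletion (CyclotomicField m ℚ)))).toTopRep),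
      (∀ σ, ηT.1 σ = η₀.1 (absGaloisRestrict (Place.Completion (Sum.inr ((primesEquiv (R := 𝓞 ℚ)).symm ⟨p, hp.out⟩) : Place ℚ)) (w.1.adicCompletion (CyclotomicField m ℚ)) σ)) →
      expStarCoordTower W' (F₀ := (Place.Completion (Sum.inr ((primesEquiv (R := 𝓞 ℚ)).symm ⟨p, hp.out⟩) : Place ℚ))) hL d ηT =
      algebraMap (Place.Completion (Sum.inr ((primesEquiv (R := 𝓞 ℚ)).symm ⟨p, hp.out⟩) : Place ℚ)) (w.1.adicCompletion (CyclotomicField m ℚ))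
      (expStarCoord W' (valuation_place_lt_one p ((primesEquiv (R := 𝓞 ℚ)).symm ⟨p, hp.out⟩)) d₀ η₀)) →
      ∃ c : (Place.Completion (Sum.inr ((primesEquiv (R := 𝓞 ℚ)).symm ⟨p, hp.out⟩) : Place ℚ)), c ≠ 0 ∧
      (∀ (η₀ : contOneCocycles (restrictedTateRep W' (Place.Completion (Sum.inr ((primesEquiv (R := 𝓞 ℚ)).symm ⟨p, hp.out⟩) : Place ℚ)) p).toTopRep)
      (P : (W'.baseChange (Place.Completion (Sum.inr ((primesEquiv (R := 𝓞 ℚ)).symm ⟨p, hp.out⟩) : Place ℚ))).toAffine.Point),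
      ((tatePairingPoint W' (Place.Completion (Sum.inr ((primesEquiv (R := 𝓞 ℚ)).symm ⟨p, hp.out⟩) : Place ℚ)) p e hμ hadd₁ hadd₂ hgal hcompat (oneCocycleClass _ η₀) P : ℤ_[p]) : ℚ_[p]) =
      Algebra.trace ℚ_[p] (Place.Completion (Sum.inr ((primesEquiv (R := 𝓞 ℚ)).symm ⟨p, hp.out⟩) : Place ℚ))
      (c * expStarCoord W' (valuation_place_lt_one p ((primesEquiv (R := 𝓞 ℚ)).symm ⟨p, hp.out⟩)) d₀ η₀ *
      padicLogPointFiniteExt wv (W'.baseChange (Place.Completion (Sum.inr ((primesEquiv (R := 𝓞 ℚ)).symm ⟨p, hp.out⟩) : Place ℚ))) p P)) ∧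
      (∀ (ηT : contOneCocycles ((restrictedTateRep W' (Place.Completion (Sum.inr ((primesEquiv (R := 𝓞 ℚ)).symm ⟨p, hp.out⟩) : Place ℚ)) p).restrict
      (absGaloisRestrict (Place.Completion (Sum.inr ((primesEquiv (R := 𝓞 ℚ)).symm ⟨p, hp.out⟩) : Place ℚ)) (w.1.adicCompletion (CyclotomicField m ℚ)))).toTopRep)
      (P : (W'.baseChange (w.1.adicCompletion (CyclotomicField m ℚ))).toAffine.Point),
      ((tatePairingPointTower W' (Place.Completion (Sum.inr ((primesEquiv (R := 𝓞 ℚ)).symm ⟨p, hp.out⟩) : Place ℚ)) e hμ hadd₁ hadd₂ hgal hcompat (oneCocycleClass _ ηT) P : ℤ_[p]) : ℚ_[p]) =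
      Algebra.trace ℚ_[p] (w.1.adicCompletion (CyclotomicField m ℚ))
      (algebraMap (Place.Completion (Sum.inr ((primesEquiv (R := 𝓞 ℚ)).symm ⟨p, hp.out⟩) : Place ℚ)) (w.1.adicCompletion (CyclotomicField m ℚ)) c * expStarCoordTower W' (F₀ := (Place.Completion (Sum.inr ((primesEquiv (R := 𝓞 ℚ)).symm ⟨p, hp.out⟩) : Place ℚ))) hL d ηT *
      padicLogPointFiniteExt ν (W'.baseChange (w.1.adicCompletion (CyclotomicField m ℚ))) p P)) := by
  intro W' _ _ p hp hp57 hadd hirr hK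
  have hp5 : 5 ≤ p := by rcases hp57 with rfl | rfl <;> norm_num
  by_cases h4 : padicValInt p W'.minimalDiscriminantInt ≤ 4
  · -- the six UNSTARRED cells: `2 ≤ ord_p Δ_min ≤ 4`
    have h2 := MemberManinUnitFiveSevenGlue.two_le_padicValInt_minimalDiscriminantInt_of_addv W' hp5 hadd
    by_cases hord : p = 5 ∧ padicValInt p W'.minimalDiscriminantInt = 3 ∨ p = 7 ∧ padicValInt p W'.minimalDiscriminantInt = 2 ∨
        p = 7 ∧ padicValInt p W'.minimalDiscriminantInt = 4
    · exact RecTowerUnstarredOrdinaryCells.recTowerUnstarredOrdinaryCells W' p hp57 hadd hirr hK hord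
    · have hss : p = 5 ∧ padicValInt p W'.minimalDiscriminantInt = 2 ∨ p = 5 ∧ padicValInt p W'.minimalDiscriminantInt = 4 ∨
          p = 7 ∧ padicValInt p W'.minimalDiscriminantInt = 3 := by
        rcases hp57 with rfl | rfl <;> omega
      exact RecTowerUnstarredSupersingularCells.recTowerUnstarredSupersingularCells W' p hp57 hadd hirr hK h4 hss
  · -- the six STARRED cells: `4 < ord_p Δ_min`, the halves of the K★ skeleton
    have h4' : 4 < padicValInt p W'.minimalDiscriminantInt := not_le.mp h4
    by_cases hsel : (p = 5 ↔ padicValInt p W'.minimalDiscriminantInt = 9)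
    · exact StarredOptimalManinUnitFiveSevenRecTowerCellsOfLocalFormulaAlt.recTowerOrdinaryCells_of_localFormulaAlt
        StarredOptimalManinUnitFiveSevenLocalFormulaOrdinaryCells.stub_localFormulaOrdinaryCells W' p hp57 hadd hirr hK h4' hsel
    · exact StarredOptimalManinUnitFiveSevenRecTowerCellsOfLocalFormulaAlt.recTowerSupersingularCells_of_localFormulaAlt
        StarredOptimalManinUnitFiveSevenLocalFormulaSupersingularCells.stub_localFormulaSupersingularCells W' p hp57 hadd hirr hK h4' hsel

variable {p : ℕ} [hp : Fact p.Prime]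

/-! ### §2 Manin's `p`-part at every lattice-optimal datum, all potentially good cells at `p ∈ {5, 7}` -/

/-- ★★★★ **Manin's `p`-part at every LATTICE-OPTIMAL datum of every `W/ℚ` with additive POTENTIALLY GOOD reduction at `p ∈ {5, 7}` and `E[p]` irreducible, GRANTED ONLY
P1-bar and modularity.** `W` globally minimal, additive at `p`, `E[p]` irreducible, no `Iₙ*` fibre at `p`, `D` a datum at any level with `Λ_W = c(D)·Λ_f`: `p ∤ c(D)` —
`not_dvd_optimal_c_of_sl2NeronValuesBar_of_recAt` with the REC socket DISCHARGED by `recTowerPotGoodFiveSeven`; = the g19 master theorem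
`not_dvd_optimal_c_fiveSeven_of_reciprocityLaw_of_sl2NeronValuesBar` WITHOUT `hrec`. CONDITIONAL on the cite-only P1-bar / modularity; nothing is closed.
[cite: Kato2004Asterisque, Thm. 6.6 (1) (p. 163), (8.1.3) (p. 180), Thm. 9.7 (p. 189)] [cite: Kato1993LNM1553, Ch. II Prop. 1.2.3 and Thm. 1.4.1 (3)–(4)]
[cite: KostersPannekoek2017, Thm. 1 and Cor. 2] [cite: Stevens1989, Lemma (5.2) p. 96] [cite: KrausOesterle1992, Prop. 1] -/
theorem not_dvd_optimal_c_potGood_of_sl2NeronValuesBar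
    (hP1 : exists_member_sl2ZetaElement_neron_values_bar) (hnf : exists_isNewformOf)
    (W : WeierstrassCurve ℚ) [W.IsElliptic] [W.IsGloballyMinimal] {N : ℕ} [NeZero N]
    (D : ModularParametrizationData W N) (hp57 : p = 5 ∨ p = 7) (hadd : Addv W p) (hirr : Irr W p)
    (hK : ∀ (v : HeightOneSpectrum ℤ) (n : ℕ), natGenerator v = p → W.kodairaSymbolAt v ≠ KodairaSymbol.Istar n)
    (hopt : ∀ z ∈ D.L.lattice, ∃ w ∈ periodLattice D.f, z = D.c * w) :
    ¬ (p : ℤ) ∣ D.c := by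
  refine not_dvd_optimal_c_of_sl2NeronValuesBar_of_recAt (n := padicValInt p W.minimalDiscriminantInt) ?_ hP1 hnf W D hp57 hadd hirr hK rfl hopt
  intro W' _ _ hadd' hirr' hK' _
  exact recTowerPotGoodFiveSeven W' p hp57 hadd' hirr' hK'

omit hp in
/-- A datum with `p ∤ c` at level `N` is one at any level `M = N`. [folklore] -/
private theorem exists_datum_not_dvd_of_level_eq {W : WeierstrassCurve ℚ} {N M : ℕ} [NeZero N]
    [NeZero M] (h : N = M) (D : ModularParametrizationData W N) (hc : ¬ (p : ℤ) ∣ D.c) :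
    ∃ D' : ModularParametrizationData W M, ¬ (p : ℤ) ∣ D'.c := by
  subst h
  exact ⟨D, hc⟩

/-- ★★ **A conductor-level datum with `p ∤ c` on every additive potentially good `V/ℚ` at `p ∈ {5, 7}` with `E[p]` irreducible, GRANTED ONLY P1-bar and modularity.**
`V` globally minimal, additive at `p`, `E[p]` irreducible, no `Iₙ*` at `p`: SOME conductor-level datum `D` of `V` has `p ∤ c(D)` — the previous theorem at the optimal
member `V₀ ∼ V` (`X12.exists_isIsogenous_optimal`; cell data along the isogeny `cellData_of_isIsogenous`, Dokchitser–Dokchitser the tree theorem), transported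
back to `V` (`ManinFrameTransport.exists_modularParametrizationData_not_dvd_of_partner`). CONDITIONAL; nothing closed.
[cite: Kato2004Asterisque, (8.1.3) (p. 180), Thm. 9.7 (p. 189)] [cite: DokchitserDokchitser2015LocalInvariants, Thm. 5.1 (1)] -/
theorem exists_datum_not_dvd_c_potGood_of_sl2NeronValuesBar
    (hP1 : exists_member_sl2ZetaElement_neron_values_bar) (hnf : exists_isNewformOf)
    (V : WeierstrassCurve ℚ) [V.IsElliptic] [V.IsGloballyMinimal] [NeZero (V.conductorNorm ℤ)]
    (hp57 : p = 5 ∨ p = 7) (hadd : Addv V p) (hirr : Irr V p)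
    (hK : ∀ (v : HeightOneSpectrum ℤ) (n : ℕ), natGenerator v = p → V.kodairaSymbolAt v ≠ KodairaSymbol.Istar n) :
    ∃ D : ModularParametrizationData V (V.conductorNorm ℤ), ¬ (p : ℤ) ∣ D.c := by
  obtain ⟨V₀, hE₀, hM₀, hNz₀, D₀, hiso, hN, hopt₀⟩ := X12.exists_isIsogenous_optimal hnf V
  haveI := hE₀
  haveI := hM₀
  haveI := hNz₀
  obtain ⟨hadd₀, hirr₀, hK₀, -⟩ := StarredOptimalManinUnitFiveSevenCellDataOfIsogenous.cellData_of_isIsogenous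
    Literature.NumberTheory.EllipticCurves.dokchitser_padicValInt_minimalDiscriminantInt_eq_of_isogeny_of_not_dvd_degree_holds hiso hp57 hadd hirr hK
  have hc₀ : ¬ (p : ℤ) ∣ D₀.c := not_dvd_optimal_c_potGood_of_sl2NeronValuesBar hP1 hnf V₀ D₀ hp57 hadd₀ hirr₀ hK₀ hopt₀
  obtain ⟨D, hc⟩ := ManinFrameTransport.exists_modularParametrizationData_not_dvd_of_partner V hp.out hirr hiso D₀ hc₀
  exact exists_datum_not_dvd_of_level_eq hN D hc

/-! ### §3 The route's Manin items by name, GRANTED ONLY {modularity, P1-bar} -/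

/-- ★★★ **LOW `SupersingularTorsionOptimalManinUnitFive` (stmt-BirchSwinnertonDyer-23884; shared verbatim with route TeichmullerTwistDescent) GRANTED ONLY modularity
and P1-bar** — its cell `(5; II)` (resp. the empty clauses `(5; III)`, `(7; II)` under `¬ TypeGOrd`) is potentially good; the supersingularity and torsion binders are
not used; [REC-tower] there is the LEAD's `recTowerUnstarredSupersingularCells` ((N1‴) tower descent). CONDITIONAL; the item stays OPEN; BSD is not proved by this.
[cite: Kato2004Asterisque, (8.1.3) (p. 180), Thm. 9.7 (p. 189)] [cite: KostersPannekoek2017, Cor. 2] -/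
theorem supersingularTorsionOptimalManinUnitFive_of_sl2NeronValuesBar (hnf : exists_isNewformOf)
    (hP1 : exists_member_sl2ZetaElement_neron_values_bar) :
    SupersingularTorsionOptimalManinUnitFive := by
  intro W _ _ p _ _ D hcell hadd hirr _ _ hopt
  have hp57 : p = 5 ∨ p = 7 := by rcases hcell with ⟨h, -⟩ | ⟨h, -⟩ <;> simp [h]
  have h4 : padicValInt p W.minimalDiscriminantInt ≤ 4 := by
    rcases hcell with ⟨-, h | h⟩ | ⟨-, h⟩ <;> omega
  exact not_dvd_optimal_c_potGood_of_sl2NeronValuesBar hP1 hnf W D hp57 hadd hirr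
    (OptimalManinUnitFiveSevenOfReciprocityLaw.forall_ne_Istar_of_padicValInt_le_four W (by omega) hadd h4) hopt

/-- ★★★ **KP57 `KPResidueManinUnitFiveSeven` (stmt-BirchSwinnertonDyer-23810) GRANTED ONLY modularity and P1-bar** — of the item's hypotheses only `p ∈ {5, 7}`,
additivity, `E[p]`-irreducibility and «no `Iₙ*`» are used (`exists_datum_not_dvd_c_potGood_of_sl2NeronValuesBar`). CONDITIONAL; the item stays OPEN; BSD is not
proved by this. [cite: Kato2004Asterisque, (8.1.3) (p. 180), Thm. 9.7 (p. 189)] [cite: KostersPannekoek2017, Thm. 1 and Cor. 2] -/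
theorem kpResidueManinUnitFiveSeven_of_sl2NeronValuesBar (hnf : exists_isNewformOf)
    (hP1 : exists_member_sl2ZetaElement_neron_values_bar) :
    KPResidueManinUnitFiveSeven := by
  intro p _ V _ _ _ hp57 hadd hirr hK _ _ _ _
  exact exists_datum_not_dvd_c_potGood_of_sl2NeronValuesBar hP1 hnf V hp57 hadd hirr hK

/-- ★★★ **TDS57 `TwistDegreeStepFiveSeven` (stmt-BirchSwinnertonDyer-22227) GRANTED ONLY P1-bar** (modularity is the item's own first binder): a conductor-level datum
`D` of `V` with `p ∤ c(D)` (`exists_datum_not_dvd_c_potGood_of_sl2NeronValuesBar`) has `v_p(deg D) < v_p(deg D♭)` for every conductor-level datum of the `p*`-twist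
(`TwistDegreeStepFiveSeven.twistDegreeStep57_of_not_dvd_c`: the twist identity, 5 ≤ p). No F″, no [REC-tower], no Ihara, no KP hypothesis. CONDITIONAL; the item stays
OPEN; BSD is not proved by this. [cite: Kato2004Asterisque, Thm. 6.6 (1) (p. 163), (8.1.3) (p. 180), Thm. 9.7 (p. 189)] [cite: EdixhovenManin1991, §4 (cases 1/2)]
[cite: ZagierCMB1985, §1 (p. 374)] -/
theorem twistDegreeStepFiveSeven_of_sl2NeronValuesBar (hP1 : exists_member_sl2ZetaElement_neron_values_bar) :
    TwistDegreeStepFiveSeven := by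
  intro hnf p _ V _ _ _ Wf _ _ _ C hp57 hadd hirr hK hV4 hC
  have hp5 : 5 ≤ p := by omega
  obtain ⟨D, hc⟩ := exists_datum_not_dvd_c_potGood_of_sl2NeronValuesBar hP1 hnf V hp57 hadd hirr hK
  exact ⟨D, TwistDegreeStepFiveSeven.twistDegreeStep57_of_not_dvd_c hp5 V Wf hadd hK hV4 C hC D hc⟩

/-- ★★★ **K★ `StarredOptimalManinUnitFiveSeven` (stmt-BirchSwinnertonDyer-22226) once more, as the starred sub-case of the twelve-cell theorem, GRANTED modularity and
P1-bar** (the line's closer `…LocalFormulaOrdinaryCells.starredOptimalManinUnitFiveSeven_of_sl2NeronValuesBar`, p801055, does not need modularity; recorded for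
uniformity only). CONDITIONAL; the item stays OPEN. [cite: Kato2004Asterisque, (8.1.3) (p. 180), Thm. 9.7 (p. 189)] [cite: EdixhovenManin1991, Thm. 3] -/
theorem starredOptimalManinUnitFiveSeven_of_sl2NeronValuesBar' (hnf : exists_isNewformOf)
    (hP1 : exists_member_sl2ZetaElement_neron_values_bar) :
    StarredOptimalManinUnitFiveSeven := by
  intro W _ _ p _ _ D hp57 hadd hirr hK _ hopt
  exact not_dvd_optimal_c_potGood_of_sl2NeronValuesBar hP1 hnf W D hp57 hadd hirr hK hopt

/-! ### §4 The rung of the route, with [REC-tower] replaced by the item TDS11 -/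

/-- ★★ **The rung `WAllExclAdditiveFiveLeRankOne` (W-ALL/2.p>=5.r1) GRANTED P1-bar, the crux TDS11 `TwistDegreeStepOrdinary` (22228), the three AKR-shared open
cruxes and the two published-input bundles** — through the landed `EdixhovenFibreFiveSevenAssembly.assembly_proof` (22231) fed with K★
(`…LocalFormulaOrdinaryCells.starredOptimalManinUnitFiveSeven_of_sl2NeronValuesBar`, p801055), TDS57 (`twistDegreeStepFiveSeven_of_sl2NeronValuesBar`, this file) and the
closed glue G57 (`memberManinUnitFiveSevenGlue_proof`). = `wAllExclAdditiveFiveLeRankOne_of_akr_of_reciprocityLaw_of_sl2NeronValuesBar` (g19) with Kato's explicit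
reciprocity law `hrec` NO LONGER AN INPUT at `p ∈ {5, 7}`; at `p ≥ 11` it enters only through the item TDS11 (open). CONDITIONAL (one cite-only printed fact + four OPEN
cruxes + two hypothesis-only bundles); no item is closed; BSD is not proved and no W-ALL class theorem is proved by this.
[cite: Kato2004Asterisque, Thm. 6.6 (1) (p. 163), (8.1.3) (p. 180), Thm. 9.7 (p. 189)] [cite: WZhang2014, Thm. 1.1] -/
theorem wAllExclAdditiveFiveLeRankOne_of_akr_of_twistDegreeStepOrdinary_of_sl2NeronValuesBar
    (hP1 : exists_member_sl2ZetaElement_neron_values_bar) (hO : TwistDegreeStepOrdinary)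
    (h₁ : KolyvaginPrimitiveAdditive) (h₀ : RankZeroAdditive) (hoff : OffSharpRankOneAdditive)
    (hP : PublishedInputsAdditiveKoly) (hF : PublishedManinFacts) :
    Summit.BirchSwinnertonDyer.WAllExclAdditiveFiveLeRankOne :=
  EdixhovenFibreFiveSevenAssembly.assembly_proof
    (StarredOptimalManinUnitFiveSevenLocalFormulaOrdinaryCells.starredOptimalManinUnitFiveSeven_of_sl2NeronValuesBar hP1)
    (twistDegreeStepFiveSeven_of_sl2NeronValuesBar hP1) hO
    MemberManinUnitFiveSevenGlue.memberManinUnitFiveSevenGlue_proof h₁ h₀ hoff hP hF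

end Summit.BirchSwinnertonDyer.BirchSwinnertonDyer.Theorems.PotGoodManinUnitOfSL2NeronValuesBar

end
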